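import Summits.CriticalPhenomena.PercolationContinuityZ3.Theorems.PercNearOneGluingNoHeavyLowerTailThreePointHalvingFibreCriterion
import Mathlib.Order.UpperLower.Basic
import HarnessLib

/-!
# The telescoping identity for two-replica fibre sums (Sahi programme, prover prim-sahi-p2 gen 44, Theorem T with a fixed order)

Support file (`--supports stmt-CriticalPhenomena-4575`, helper).  Bookkeeping definitions only (`hyb`, `swapAt`, `indSet`, `Fh`, `stepTerm`,
`stepsSum`); no named facts, no sorries.  Memo `run/shared/lean/prim/prim-sahi/FROM-prim-sahi-p2-gen44-TELESCOPING.md` §3; PROOF-E3 §54 (54c).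

For two events `U, D ⊆ 2^ι` and a count vector `I` (a "fibre" of replica pairs `t = (t₁,t₂)`, see `…ThreePointHalvingFibreCriterion`),
interpolate between `good_I = #{t : t₁ ∈ U ∩ D}` and `bad_I = #{t : t₁ ∈ U, t₂ ∈ D}` through the hybrids `hyb S t = (t₂ on S, t₁ off S)`
along ANY enumeration `e₁, e₂, …` of the coordinates.  Swapping the coordinate `e` between the two replicas is a fibre-preserving involution,
and symmetrising each increment over it gives the exact formula (`two_mul_Fh_sub_eq_stepsSum`, `telescope_pairCount`)
  `2·(bad_I − good_I) = Σ_k Σ_{t ∈ fibre I} (𝟙_U(t₁^{e_k ← t₂ e_k}) − 𝟙_U(t₁))·(𝟙_D(h_{k−1}(t)) − 𝟙_D(h_{k−1}(t)^{e_k ← t₂ e_k}))`,  `h_{k−1} = hyb {e₁..e_{k−1}}`,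
valid for ARBITRARY `U, D`; for an up-set `U` and a down-set `D` every term is `≥ 0` (`stepTerm_nonneg`) and is the indicator that `e_k` is
pivotal for `U` at `t₁` and for `D` at the hybrid (the "doubly pivotal" count of the memo), whence `good_I ≤ bad_I` fibrewise
(`sum_ind2_inter_le`) and, at the first step, the vanishing of the increment whenever no coordinate is doubly pivotal in one
configuration.  This is the complementary-coupling (ρ = −1) analogue of the Russo–Margulis / OSSS-type covariance telescoping. [this work]
([folklore] for the hybrid/swap bookkeeping)
-/

namespace Summit.CriticalPhenomena.PercolationContinuityZ3.Theorems

namespace HalvingFibre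

open Finset
open Summit.CriticalPhenomena.PercolationContinuityZ3.Cruxes.AdditiveGluing.TieLine.FibreCount (cfg)
open Classical

noncomputable section Telescope

variable {ι : Type*} [Fintype ι]

/-- The hybrid of a replica pair: second replica on `S`, first replica off `S`. [folklore] -/
def hyb (S : Finset ι) (t : Pair ι) : ι → Bool := fun i => if i ∈ S then t.2 i else t.1 i

/-- Swap the coordinate `e` between the two replicas. [folklore] -/
def swapAt (e : ι) (t : Pair ι) : Pair ι := (Function.update t.1 e (t.2 e), Function.update t.2 e (t.1 e))

omit [Fintype ι] in
/-- `swapAt e` is an involution. [folklore] -/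
theorem swapAt_swapAt (e : ι) (t : Pair ι) : swapAt e (swapAt e t) = t := by
  obtain ⟨x, y⟩ := t
  unfold swapAt
  ext i
  · by_cases hi : i = e
    · subst hi; simp
    · simp [Function.update_of_ne hi]
  · by_cases hi : i = e
    · subst hi; simp
    · simp [Function.update_of_ne hi]

omit [Fintype ι] in
/-- Swapping a coordinate between the replicas does not change the count vector. [folklore] -/
theorem cnt_swapAt (e : ι) (t : Pair ι) : cnt (swapAt e t) = cnt t := by
  funext i
  unfold cnt cnt2 swapAt
  by_cases hi : i = e
  · subst hi; simp [Nat.add_comm]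
  · simp [Function.update_of_ne hi]

omit [Fintype ι] in
/-- Hybrid over `insert e S` = hybrid over `S` of the `e`-swapped pair (`e ∉ S`). [folklore] -/
theorem hyb_insert {e : ι} {S : Finset ι} (he : e ∉ S) (t : Pair ι) : hyb (insert e S) t = hyb S (swapAt e t) := by
  funext i
  unfold hyb swapAt
  by_cases hi : i = e
  · subst hi; simp [he]
  · simp [Finset.mem_insert, hi]

omit [Fintype ι] in
/-- The empty hybrid is the first replica. [folklore] -/
theorem hyb_empty (t : Pair ι) : hyb (∅ : Finset ι) t = t.1 := by
  funext i; simp [hyb]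

omit [Fintype ι] in
/-- A hybrid over a set containing every coordinate is the second replica. [folklore] -/
theorem hyb_of_forall_mem {S : Finset ι} (h : ∀ i, i ∈ S) (t : Pair ι) : hyb S t = t.2 := by
  funext i; simp [hyb, h i]

/-- `swapAt e` as an equivalence of replica pairs. [folklore] -/
def swapAtEquiv (e : ι) : Pair ι ≃ Pair ι where
  toFun := swapAt e
  invFun := swapAt e
  left_inv := swapAt_swapAt e
  right_inv := swapAt_swapAt e

/-- A fibre sum is invariant under swapping the coordinate `e` between the replicas in the summand. [folklore] -/
theorem sum_fibre_swapAt (e : ι) (I : ι → ℕ) (f : Pair ι → ℝ) :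
    ∑ t ∈ (Finset.univ : Finset (Pair ι)).filter (fun t => cnt t = I), f (swapAt e t) =
      ∑ t ∈ (Finset.univ : Finset (Pair ι)).filter (fun t => cnt t = I), f t := by
  refine Finset.sum_equiv (swapAtEquiv (ι := ι) e) (fun t => ?_) (fun t _ => rfl)
  simp only [Finset.mem_filter, Finset.mem_univ, true_and]
  show cnt t = I ↔ cnt (swapAt e t) = I
  rw [cnt_swapAt]

/-- Real indicator of an event evaluated at a Boolean vector. [folklore] -/
noncomputable def indSet (A : Set (Set ι)) (x : ι → Bool) : ℝ := if cfg x ∈ A then 1 else 0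

/-- The interpolating fibre sum `F(S) = Σ_{t ∈ fibre I} 𝟙_U(t₁)·𝟙_D(hyb S t)`. [this work] -/
noncomputable def Fh (U D : Set (Set ι)) (I : ι → ℕ) (S : Finset ι) : ℝ :=
  ∑ t ∈ (Finset.univ : Finset (Pair ι)).filter (fun t => cnt t = I), indSet U t.1 * indSet D (hyb S t)

/-- The symmetrised increment at coordinate `e` after `S`:
`Σ_{t ∈ fibre I} (𝟙_U((swapAt e t)₁) − 𝟙_U(t₁))·(𝟙_D(hyb S t) − 𝟙_D(hyb S (swapAt e t)))`. [this work] -/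
noncomputable def stepTerm (U D : Set (Set ι)) (I : ι → ℕ) (S : Finset ι) (e : ι) : ℝ :=
  ∑ t ∈ (Finset.univ : Finset (Pair ι)).filter (fun t => cnt t = I),
    (indSet U (swapAt e t).1 - indSet U t.1) * (indSet D (hyb S t) - indSet D (hyb S (swapAt e t)))

/-- **One step of the telescoping.**  For `e ∉ S`: `2·(F(insert e S) − F(S)) = stepTerm S e`. [this work] -/
theorem two_mul_Fh_insert_sub (U D : Set (Set ι)) (I : ι → ℕ) {S : Finset ι} {e : ι} (he : e ∉ S) :
    2 * (Fh U D I (insert e S) - Fh U D I S) = stepTerm U D I S e := by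
  set fib := (Finset.univ : Finset (Pair ι)).filter (fun t => cnt t = I) with hfib
  have hA : Fh U D I (insert e S) = ∑ t ∈ fib, indSet U t.1 * indSet D (hyb S (swapAt e t)) := by
    unfold Fh
    exact Finset.sum_congr rfl fun t _ => by rw [hyb_insert he]
  -- reindex both sums by the swap
  have hA' : ∑ t ∈ fib, indSet U t.1 * indSet D (hyb S (swapAt e t)) =
      ∑ t ∈ fib, indSet U (swapAt e t).1 * indSet D (hyb S t) := by
    rw [← sum_fibre_swapAt e I (fun t => indSet U t.1 * indSet D (hyb S (swapAt e t)))]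
    exact Finset.sum_congr rfl fun t _ => by rw [swapAt_swapAt]
  have hB' : Fh U D I S = ∑ t ∈ fib, indSet U (swapAt e t).1 * indSet D (hyb S (swapAt e t)) := by
    unfold Fh
    rw [← sum_fibre_swapAt e I (fun t => indSet U t.1 * indSet D (hyb S t))]
  have hB : Fh U D I S = ∑ t ∈ fib, indSet U t.1 * indSet D (hyb S t) := rfl
  have h2 : 2 * (Fh U D I (insert e S) - Fh U D I S) =
      (∑ t ∈ fib, indSet U t.1 * indSet D (hyb S (swapAt e t)) + ∑ t ∈ fib, indSet U (swapAt e t).1 * indSet D (hyb S t)) -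
        (∑ t ∈ fib, indSet U t.1 * indSet D (hyb S t) + ∑ t ∈ fib, indSet U (swapAt e t).1 * indSet D (hyb S (swapAt e t))) := by
    rw [← hA, ← hA', ← hA, ← hB, ← hB']; ring
  rw [h2, ← Finset.sum_add_distrib, ← Finset.sum_add_distrib, ← Finset.sum_sub_distrib]
  unfold stepTerm
  exact Finset.sum_congr rfl fun t _ => by ring

/-- The accumulated increments along a list of coordinates, starting after `S`. [this work] -/
noncomputable def stepsSum (U D : Set (Set ι)) (I : ι → ℕ) : List ι → Finset ι → ℝ
  | [], _ => 0
  | e :: L, S => stepTerm U D I S e + stepsSum U D I L (insert e S)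

/-- **Telescoping along a list** of distinct coordinates disjoint from `S`:
`2·(F(S ∪ L) − F(S)) = Σ_k stepTerm (S ∪ {e₁..e_{k−1}}) e_k`. [this work] -/
theorem two_mul_Fh_sub_eq_stepsSum (U D : Set (Set ι)) (I : ι → ℕ) :
    ∀ (L : List ι) (S : Finset ι), L.Nodup → (∀ e ∈ L, e ∉ S) →
      2 * (Fh U D I (S ∪ L.toFinset) - Fh U D I S) = stepsSum U D I L S := by
  intro L
  induction L with
  | nil => intro S _ _; simp [stepsSum]
  | cons e L ih =>
    intro S hnd hdisj
    have heL : e ∉ L := (List.nodup_cons.1 hnd).1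
    have hL : L.Nodup := (List.nodup_cons.1 hnd).2
    have heS : e ∉ S := hdisj e (by simp)
    have hdisj' : ∀ f ∈ L, f ∉ insert e S := by
      intro f hf
      rw [Finset.mem_insert]
      rintro (rfl | h)
      · exact heL hf
      · exact hdisj f (by simp [hf]) h
    have hset : S ∪ (e :: L).toFinset = insert e S ∪ L.toFinset := by
      ext i; simp
    rw [hset, stepsSum]
    have := ih (insert e S) hL hdisj'
    have hstep := two_mul_Fh_insert_sub U D I heS
    linarith

/-- `F(∅)` is the `good` fibre count `#{t : t₁ ∈ U ∩ D}` and `F(everything)` the `bad` fibre count `#{t : t₁ ∈ U, t₂ ∈ D}`. [this work] -/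
theorem Fh_empty_eq (U D : Set (Set ι)) (I : ι → ℕ) :
    Fh U D I ∅ = ∑ t ∈ (Finset.univ : Finset (Pair ι)).filter (fun t => cnt t = I), ind2 (U ∩ D) Set.univ t := by
  unfold Fh
  refine Finset.sum_congr rfl fun t _ => ?_
  rw [hyb_empty]
  unfold indSet ind2
  by_cases hU : cfg t.1 ∈ U <;> by_cases hD : cfg t.1 ∈ D <;> simp [hU, hD]

/-- See `Fh_empty_eq`. [this work] -/
theorem Fh_full_eq (U D : Set (Set ι)) (I : ι → ℕ) {S : Finset ι} (h : ∀ i, i ∈ S) :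
    Fh U D I S = ∑ t ∈ (Finset.univ : Finset (Pair ι)).filter (fun t => cnt t = I), ind2 U D t := by
  unfold Fh
  refine Finset.sum_congr rfl fun t _ => ?_
  rw [hyb_of_forall_mem h]
  unfold indSet ind2
  by_cases hU : cfg t.1 ∈ U <;> by_cases hD : cfg t.2 ∈ D <;> simp [hU, hD]

/-- **THEOREM T (fixed order, per fibre).**  For every list `L` enumerating all coordinates without repetition and all events `U, D`:
`2·(#{t ∈ fibre I : t₁ ∈ U, t₂ ∈ D} − #{t ∈ fibre I : t₁ ∈ U ∩ D}) = Σ_k stepTerm {e₁..e_{k−1}} e_k`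
(the two sums are `pairCount U D I` and `pairCount (U ∩ D) univ I` of `…ThreePointHalvingFibreCriterion`). [this work] -/
theorem telescope_pairCount (U D : Set (Set ι)) (I : ι → ℕ) (L : List ι) (hL : L.Nodup) (hall : ∀ i, i ∈ L) :
    2 * ((∑ t ∈ (Finset.univ : Finset (Pair ι)).filter (fun t => cnt t = I), ind2 U D t) - ∑ t ∈ (Finset.univ : Finset (Pair ι)).filter (fun t => cnt t = I), ind2 (U ∩ D) Set.univ t) =
      stepsSum U D I L ∅ := by
  have h := two_mul_Fh_sub_eq_stepsSum U D I L ∅ hL (fun e _ => Finset.notMem_empty e)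
  rw [Finset.empty_union, Fh_full_eq U D I (S := L.toFinset) (fun i => List.mem_toFinset.2 (hall i)), Fh_empty_eq] at h
  exact h

/-! ### Signs for an up-set `U` and a down-set `D` -/

omit [Fintype ι] in
/-- `cfg` is monotone for the pointwise order on Boolean vectors: updating a coordinate to `true` enlarges the configuration. [folklore] -/
theorem cfg_update_subset (x : ι → Bool) (e : ι) : cfg x ⊆ cfg (Function.update x e true) := by
  intro i hi
  by_cases hie : i = e
  · subst hie; simp [cfg]
  · simp only [cfg, Set.mem_setOf_eq] at hi ⊢; rw [Function.update_of_ne hie]; exact hi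

omit [Fintype ι] in
/-- Updating a coordinate to `false` shrinks the configuration. [folklore] -/
theorem cfg_update_false_subset (x : ι → Bool) (e : ι) : cfg (Function.update x e false) ⊆ cfg x := by
  intro i hi
  by_cases hie : i = e
  · subst hie; simp [cfg] at hi
  · simp only [cfg, Set.mem_setOf_eq] at hi ⊢; rw [Function.update_of_ne hie] at hi; exact hi

/-- **Every step term is nonnegative for an up-set `U` and a down-set `D`** (each summand is the indicator that `e` is pivotal for `U` at `t₁`
and for `D` at the hybrid, when `t₁ e ≠ t₂ e`, and `0` otherwise). [this work] -/
theorem stepTerm_nonneg {U D : Set (Set ι)} (hU : IsUpperSet U) (hD : IsLowerSet D) (I : ι → ℕ) (S : Finset ι) {e : ι} (he : e ∉ S) :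
    0 ≤ stepTerm U D I S e := by
  unfold stepTerm
  refine Finset.sum_nonneg fun t _ => ?_
  -- the hybrid of the swapped pair is the hybrid with coordinate `e` set to `t₂ e`; the hybrid itself has `t₁ e` there
  have hh : hyb S (swapAt e t) = Function.update (hyb S t) e (t.2 e) := by
    funext i; unfold hyb swapAt
    by_cases hi : i = e
    · subst hi; simp [he]
    · simp [hi]
  have h1 : (swapAt e t).1 = Function.update t.1 e (t.2 e) := rfl
  have hhe : hyb S t = Function.update (hyb S t) e (t.1 e) := by
    funext i; by_cases hi : i = e
    · subst hi; simp [hyb, he]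
    · rw [Function.update_of_ne hi]
  rw [hh, h1]
  unfold indSet
  cases h2e : t.2 e <;> cases h1e : t.1 e
  · -- both false: no change
    have : Function.update t.1 e false = t.1 := by rw [← h1e]; exact Function.update_eq_self e t.1
    have h' : Function.update (hyb S t) e false = hyb S t := by
      conv_rhs => rw [hhe]
      rw [h1e]
    rw [this, h'];  simp
  · -- t₁ e = true, t₂ e = false: U can only decrease, D can only increase
    have hUle : (if cfg (Function.update t.1 e false) ∈ U then (1:ℝ) else 0) ≤ (if cfg t.1 ∈ U then 1 else 0) := by
      by_cases h : cfg (Function.update t.1 e false) ∈ U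
      · have : cfg t.1 ∈ U := hU (cfg_update_false_subset t.1 e) h
        simp [h, this]
      · simp [h]; split_ifs <;> norm_num
    have hDle : (if cfg (hyb S t) ∈ D then (1:ℝ) else 0) ≤ (if cfg (Function.update (hyb S t) e false) ∈ D then 1 else 0) := by
      by_cases h : cfg (hyb S t) ∈ D
      · have : cfg (Function.update (hyb S t) e false) ∈ D := hD (cfg_update_false_subset (hyb S t) e) h
        simp [h, this]
      · simp [h]; split_ifs <;> norm_num
    nlinarith
  · -- t₁ e = false, t₂ e = true: U can only increase, D can only decrease
    have hUle : (if cfg t.1 ∈ U then (1:ℝ) else 0) ≤ (if cfg (Function.update t.1 e true) ∈ U then 1 else 0) := by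
      by_cases h : cfg t.1 ∈ U
      · have : cfg (Function.update t.1 e true) ∈ U := hU (cfg_update_subset t.1 e) h
        simp [h, this]
      · simp [h]; split_ifs <;> norm_num
    have hDle : (if cfg (Function.update (hyb S t) e true) ∈ D then (1:ℝ) else 0) ≤ (if cfg (hyb S t) ∈ D then 1 else 0) := by
      by_cases h : cfg (Function.update (hyb S t) e true) ∈ D
      · have : cfg (hyb S t) ∈ D := hD (cfg_update_subset (hyb S t) e) h
        simp [h, this]
      · simp [h]; split_ifs <;> norm_num
    nlinarith
  · -- both true: no change
    have : Function.update t.1 e true = t.1 := by rw [← h1e]; exact Function.update_eq_self e t.1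
    have h' : Function.update (hyb S t) e true = hyb S t := by
      conv_rhs => rw [hhe]
      rw [h1e]
    rw [this, h']; simp

/-- All accumulated increments are nonnegative for an up-set `U` and a down-set `D`. [this work] -/
theorem stepsSum_nonneg {U D : Set (Set ι)} (hU : IsUpperSet U) (hD : IsLowerSet D) (I : ι → ℕ) :
    ∀ (L : List ι) (S : Finset ι), L.Nodup → (∀ e ∈ L, e ∉ S) → 0 ≤ stepsSum U D I L S := by
  intro L
  induction L with
  | nil => intro S _ _; simp [stepsSum]
  | cons e L ih =>
    intro S hnd hdisj
    have heL : e ∉ L := (List.nodup_cons.1 hnd).1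
    have heS : e ∉ S := hdisj e (by simp)
    have hdisj' : ∀ f ∈ L, f ∉ insert e S := by
      intro f hf
      rw [Finset.mem_insert]
      rintro (rfl | h)
      · exact heL hf
      · exact hdisj f (by simp [hf]) h
    rw [stepsSum]
    exact add_nonneg (stepTerm_nonneg hU hD I S heS) (ih (insert e S) (List.nodup_cons.1 hnd).2 hdisj')

/-- **`good ≤ bad` fibrewise** for an up-set `U` and a down-set `D`: `#{t : t₁ ∈ U ∩ D} ≤ #{t : t₁ ∈ U, t₂ ∈ D}` in every fibre
(the complementary-coupling form of Harris' inequality, as a corollary of the telescoping). [this work] -/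
theorem sum_ind2_inter_le {U D : Set (Set ι)} (hU : IsUpperSet U) (hD : IsLowerSet D) (I : ι → ℕ) :
    ∑ t ∈ (Finset.univ : Finset (Pair ι)).filter (fun t => cnt t = I), ind2 (U ∩ D) Set.univ t ≤ ∑ t ∈ (Finset.univ : Finset (Pair ι)).filter (fun t => cnt t = I), ind2 U D t := by
  obtain ⟨L, hL, hall⟩ : ∃ L : List ι, L.Nodup ∧ ∀ i, i ∈ L :=
    ⟨(Finset.univ : Finset ι).toList, Finset.nodup_toList _, fun i => Finset.mem_toList.2 (Finset.mem_univ i)⟩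
  have h := telescope_pairCount U D I L hL hall
  have h0 := stepsSum_nonneg hU hD I L ∅ hL (fun e _ => Finset.notMem_empty e)
  linarith

end Telescope

end HalvingFibre

end Summit.CriticalPhenomena.PercolationContinuityZ3.Theorems
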